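import Summits.BirchSwinnertonDyer.BirchSwinnertonDyer.Theorems.InertBadSignedBranchesPrintReadingsOfLiterature
import Summits.BirchSwinnertonDyer.Rank1Residual.Additive.QuadraticBranchBSDpOfReadings
import Summits.BirchSwinnertonDyer.Rank1Residual.X12.ClassClosureO10Readings
import HarnessLib

/-!
# Route `InertBadSignedBranches` (rung K8): the O10 / quadratic-branch consumers in KOBAYASHI'S
# (K)-FORM — `BSD(W, p)` from C-cc-1 with (C1_η) displayed as «Char(X⁺(V/K_∞)^η) = (L_p⁺(V, η, X))»
# on the η-component object, the (F)-form `QuadraticBranchPlusMainConjectureAt` GONE from every binder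

Cell `b2b-bsdres`, unit `b2b-bsdres-x1b` (X12 prover owner / O10 vocabulary owner, gen 47), answering the
cell bsd-cm planner's ask D85 (HOME/bsd-cm-plan/g14/START-HERE.md «b2b-bsdres x1b — (D85) a signature-only
(K)-form variant of the O10 consumer … + the matching bridge variant»; k8i-ty MEMO-19226-FORMS §2).
HONEST FRAMING (verbatim in every file of the cell): the cell DELETES the combination-shaped residual classes
of the BSD formula in analytic rank `≤ 1` from PUBLISHED theorems only and TYPES the construction-shaped
ones; O10 is CONSTRUCTION-SHAPED and stays so; tool theorems only, CONDITIONAL on every displayed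
hypothesis; (C1_η) in ANY form and C-cc-1 are NOT claimed; nothing booked; no label moves.

WHAT THIS FILE DOES. In x1b's chain (files [123] `…OddStrictExactControlDischarge`, [124]
`…BSDpOfReadings`) and in cell bsd-cm's class node (`X12/ClassClosureO10Readings`, p402929) the (F)-form
proposition `Additive.QuadraticBranchPlusMainConjectureAt V p` is never consumed for its content: it is only
the ANTECEDENT of the exact-reading binder `h74x` (k8i-ty MEMO-19226-FORMS §2, kernel trace). Here the
chain is re-assembled WITHOUT that antecedent:
* §1 `exactControl_of_exactReading` — (C3_η)'s CONTENT (finiteness of `Sel_str(W/ℚ)[p^∞]` and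
  `ord_p #Sel_str + n + ord_p(Tam/#tors²) = v_p(coeff₁ L)`) for every good-`a_p = 0` twin datum, from
  `hPT` (Poitou–Tate), GZK, (R2) and the (F)-FREE exact reading `hExact` («`Char X^{−,str}(W) = (L′)`,
  `L_η = X·L′`» on every strict-minus dual datum of `W`) — proof word for word [123]'s, the (F)-antecedent
  never having been used;
* §2 `bsdp_of_pAdicGrossZagierValuation_of_exactReading` — `BSD(W, p)` ⟸ C-cc-1 (`h2`, offset `0`) ∧
  `hExact` ∧ (R2) ∧ named facts (hmod hGZ hGZK hPT) for a rank-one `W` with its twin datum (= [124] with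
  `h1`/`h74x` replaced by `hExact`);
* §3 `exactReading_of_etaEvenMC` — `hExact` ⟸ Kobayashi 2003 Thm. 7.4 at `η` (NAMED FACT `h74 :
  Kobayashi2003.thm74_etaEvenMC_iff_etaOddMC`) ∧ the (K)-FORM even main conjecture at `η` for CM `V`
  (`hC1K`, VERBATIM the binder of k8i-ty's `printReadingsInert_of_plusMCEtaCM`; Pollack–Rubin p. 448
  remark — conjecture-grade, DISPLAYED), for `W` CM (its twins are CM); proof = the second bullet of
  `printReadingsInert_of_plusMCEtaCM` (p419xxx), whose (F)-antecedent `_h1` was unused;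
* §4 the PAIR consumer in (K)-form `bsdp_of_hasSignedLocalType_IstarZero_of_valuation_of_etaEvenMC` —
  `BSD(W, p)` for `W` of signed type `(p, I₀*)`, `r_an = 1`, `p ≥ 5` ⟸ C-cc-1(W, p) ∧ `hC1K` ∧ named facts
  (hmod hGZ hGZK hPT hnf hM hKO h74) — NO `hC1`, NO `h74x`, NO `hper` (Mazur); `missingLowerBoundAt_…`,
  `missingInputAt_…`;
* (the CLASS / bridge shape — crux `CccOneLawOnTypeIstarZero` ∧ `hC1K` ∧ `PublishedFactsInert` ∧ (hKO h74)
  ⟹ `BSDp` / `LowerHalfOnType p I₀*` on the type — is the sequel `…KFormBridge.lean`.)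
With this file a restatement of 19226's conjunct 1 in (K)-form (planner D85) has its consumers; the reading
flag `Kob03-MC-eta-quadratic-subtower` leaves the cone of every theorem here.

References: S. Kobayashi, Invent. Math. 152 (2003) §4 (p. 8), Thm. 7.4 (p. 13); T. Kitajima, R. Otsuki,
Tokyo J. Math. 41 (2018) Main Thm. 1.3; R. Pollack, K. Rubin, Ann. of Math. 159 (2004) p. 448;
HOME `b2b-bsdres-x1b/X12-ROUTE.md` §51; pub/bsd-cm MEMO-19226-FORMS §2.
-/

set_option autoImplicit false
set_option linter.dupNamespace false

noncomputable section

open scoped Classical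

open CongruenceSubgroup Field Function NumberField IsDedekindDomain WeierstrassCurve
open Literature.NumberTheory.EllipticCurves
open Literature.NumberTheory.EllipticCurves.ModularForms
open Literature.NumberTheory.EllipticCurves.Rank1Residual
open Literature.NumberTheory.EllipticCurves.Rank1Residual.Typed
open Literature.NumberTheory.GaloisRepresentations
open Literature.NumberTheory.GaloisCohomology
open Literature.NumberTheory.EllipticCurves.IwasawaAlgebra
open ZpExtension
open Summit.BirchSwinnertonDyer.Rank1Residual Summit.BirchSwinnertonDyer.Rank1Residual.Additive
open Summit.BirchSwinnertonDyer.Rank1Residual.Additive.LevelBridge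
open Summit.BirchSwinnertonDyer.Rank1Residual.X12.O10
open Summit.BirchSwinnertonDyer.BirchSwinnertonDyer.Theorems.PrintReadingsOfLiterature

namespace Summit.BirchSwinnertonDyer.BirchSwinnertonDyer.Theorems.KFormReadings

variable (W : WeierstrassCurve ℚ) [W.IsElliptic] [W.IsGloballyMinimal] (p : ℕ) [hp : Fact p.Prime]

/-! ## §1 (C3_η)'s content from the (F)-FREE exact reading -/

/-- **EXACT BOTTOM-LAYER CONTROL ON THE ODD BRANCH FROM THE (F)-FREE EXACT READING.** For `W/ℚ`
globally minimal, `p ≥ 5`, every good-`a_p = 0` twin datum `(V, C, f, ϖ, L)`, `W(ℚ_p)[p] = 0`, a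
generator `P` of level `n`: granted Poitou–Tate `hPT`, GZK, the Kitajima–Otsuki reading
(R2) `hR2` and the EXACT READING `hExact` — for every strict-minus dual datum `D` of `W` over the
cyclotomic tower and `L = X·L′`, `Char(D) = (L′)`, with NO main-conjecture antecedent —
`Sel_str(W/ℚ)[p^∞]` is finite and `ord_p #Sel_str + n + ord_p(Tam(W)/#tors²) = v_p(coeff₁ L)`.
Word for word x1b's [123] `quadraticBranchOddStrictExactControlOfPlusMCAt_of_readings` with the unused
(F)-antecedent removed. CONDITIONAL; nothing booked. [cite: Kobayashi2003, §4 (p. 8), Thm. 7.4 (p. 13)]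
[cite: KitajimaOtsuki2018, Main Thm. 1.3] -/
theorem exactControl_of_exactReading
    (hPT : poitouTate_selmerStructure_duality_real ℚ)
    (hGZK : rank_eq_analyticRank_of_analyticRank_le_one)
    (hR2 : OddBranchStrictMinusNoFiniteSubmoduleAt W p)
    (hExact : ∀ (V : WeierstrassCurve ℚ) [V.IsElliptic] [V.IsGloballyMinimal] (C : VariableChange ℚ)
        {N : ℕ} [NeZero N] {f : CuspForm (Gamma0 N) 2},
        p ≠ 2 → C • W.quadraticTwist ((-1) ^ (p / 2) * p) = V →
        V.HasGoodReductionAtPrime p → V.frobeniusTrace p = 0 → IsNewformOf V f →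
        ∀ (ϖ : ℚ), (if Even (p / 2) then (ϖ : ℝ) * V.realPeriodRat = plusPeriod f
            else (ϖ : ℝ) * V.imaginaryPeriodRat = minusPeriod f) →
        ∀ (Lη : IwasawaAlgebra p), IsQuadraticBranchMinusLFunction f p ϖ Lη →
        ∀ (κ : ZpExtension ℚ p) (γ : Field.absoluteGaloisGroup ℚ),
          κ.IsCyclotomic → κ.IsTopGenerator γ → IsCyclotomicVariable p γ →
        ∀ (D : StrictSignedSelmerDualData W κ ℚ_[p] γ (-1)) (L' : IwasawaAlgebra p),
          Lη = PowerSeries.X * L' → D.charIdeal = Ideal.span {L'})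
    (V : WeierstrassCurve ℚ) [V.IsElliptic] [V.IsGloballyMinimal] (C : VariableChange ℚ)
    {N : ℕ} [NeZero N] {f : CuspForm (Gamma0 N) 2} (hp5 : 5 ≤ p)
    (hCV : C • W.quadraticTwist ((-1) ^ (p / 2) * p) = V)
    (hgood : V.HasGoodReductionAtPrime p) (hap : V.frobeniusTrace p = 0) (hr : W.analyticRank = 1)
    (hf : IsNewformOf V f) (ϖ : ℚ)
    (hϖ : if Even (p / 2) then (ϖ : ℝ) * V.realPeriodRat = plusPeriod f
        else (ϖ : ℝ) * V.imaginaryPeriodRat = minusPeriod f)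
    (L : IwasawaAlgebra p) (hL : IsQuadraticBranchMinusLFunction f p ϖ L)
    (htors : ∀ Q : (W.baseChange ℚ_[p]).toAffine.Point, p • Q = 0 → Q = 0)
    (P : W.toAffine.Point) (n : ℕ) (hP : ¬ IsOfFinAddOrder P)
    (hgen : ∀ R : W.toAffine.Point, ∃ (k : ℤ) (T : W.toAffine.Point), IsOfFinAddOrder T ∧ R = k • P + T)
    (hdiv : ∃ Q : (W.baseChange ℚ_[p]).toAffine.Point, p ^ n • Q = W.toPadicPoint p P)
    (hndiv : ∀ Q : (W.baseChange ℚ_[p]).toAffine.Point, p ^ (n + 1) • Q ≠ W.toPadicPoint p P) :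
    Finite ↥(strictSelmerPInfty W p) ∧
      (padicValNat p (Nat.card ↥(strictSelmerPInfty W p)) : ℤ) + n +
          padicValRat p ((W.tamagawaProduct : ℚ) / (W.torsionOrder : ℚ) ^ 2) =
        ((PowerSeries.coeff 1 L : ℤ_[p]) : ℚ_[p]).valuation := by
  have hp2 : p ≠ 2 := by omega
  set v₀ := (Rat.HeightOneSpectrum.primesEquiv (R := 𝓞 ℚ)).symm ⟨p, hp.out⟩ with hv₀
  -- GZK: `Ш(W)` is finite
  obtain ⟨-, hfin⟩ := hGZK W hr.le
  haveI : Finite W.sha := hfin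
  haveI hSha : Finite (AddCommGroup.primaryComponent W.sha p) := inferInstance
  -- the cyclotomic `ℤ_p`-extension of `ℚ` and a normalised topological generator `γ`
  obtain ⟨γ, hγ, hχ⟩ := CyclotomicZp.exists_isTopGenerator_zpExtension p
  have hκ := CyclotomicZp.isCyclotomic_zpExtension p
  have hγc : IsCyclotomicVariable p γ := ⟨1, IsOfFinOrder.one, by rw [mul_one]; exact hχ⟩
  -- a strict-minus dual datum of `Sel^{−,str}(W/ℚ_∞)` at the model `ℚ_[p]`
  obtain ⟨D⟩ := nonempty_strictSignedSelmerDualData W (CyclotomicZp.zpExtension p) ℚ_[p] (-1) hγ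
  -- `L = X·L'`, `L'(0) = coeff₁ L`, and `char X^{−,str} = (L')` by the (F)-free exact reading
  obtain ⟨L', hLL', hL'0⟩ := hL.exists_eq_X_mul
  have hchar : D.charIdeal = Ideal.span {L'} :=
    hExact V C hp2 hCV hgood hap hf ϖ hϖ L hL _ γ hκ hγ hγc D L' hLL'
  -- the exceptional set `T`: the places `≠ v₀` off which `W` has good reduction
  obtain ⟨S, hS⟩ := exists_finset_forall_not_mem_good W p
  have hpT : v₀ ∉ S.erase v₀ := fun h ↦ (Finset.mem_erase.mp h).1 rfl
  have hTmem : ∀ v : HeightOneSpectrum (𝓞 ℚ), v ≠ v₀ →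
      p ∣ (W.baseChange (v.adicCompletion ℚ)).localTamagawaNumber (v.adicCompletionIntegers ℚ) →
        v ∈ S.erase v₀ := by
    intro v hv hdvd
    refine Finset.mem_erase.mpr ⟨hv, ?_⟩
    by_contra hvS
    rw [W.localTamagawaNumber_eq_one_of_hasGoodReductionAt_holds v (hS v hvS).2] at hdvd
    exact hp.out.one_lt.ne' (Nat.dvd_one.mp hdvd)
  -- the Selmer side (x1b [122], with (R2)): `#Ш[p^∞] · (p^{2n} · ∏_T p^{ord_p c_ℓ}) = p^{ord_p L'(0)}`
  have hSel := card_sha_mul_eq_pow_of_oddBranchNoFiniteSubmodule_of_quadraticTwist_signedPrime_rankOne W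
    (CyclotomicZp.zpExtension p) hp2 hκ C V hCV hgood hap hPT P hP hgen hdiv hndiv (S.erase v₀) hpT hTmem hγ D
    hchar hR2
  -- the index: `#Sel_str(W/ℚ)[p^∞] = p^n · #Ш[p^∞]`
  have hidx := StrictSha.strictSelmerIndexAt_holds W p P n hP hgen htors hdiv hndiv
  -- bookkeeping
  have hv0 := padicValNat_localTamagawaNumber_eq_zero_of_quadraticTwist_signedPrime W p hp5 C V hCV hgood
  have hTamSum := sum_padicValNat_localTamagawaNumber_eq_padicValNat_tamagawaProduct W p (S.erase v₀) hpT
    hTmem hv0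
  have htors0 := padicValNat_torsionOrder_eq_zero_of_noPTorsion W p htors
  -- numerics
  have hSha0 : Nat.card (AddCommGroup.primaryComponent W.sha p) ≠ 0 := Nat.card_pos.ne'
  have hp0 : p ≠ 0 := hp.out.ne_zero
  rw [Finset.prod_pow_eq_pow_sum, ← pow_add, hTamSum] at hSel
  have hval := congrArg (padicValNat p) hSel
  rw [padicValNat.mul hSha0 (pow_ne_zero _ hp0), padicValNat.prime_pow, padicValNat.prime_pow] at hval
  have hidxval : padicValNat p (Nat.card ↥(strictSelmerPInfty W p)) =
      n + padicValNat p (Nat.card (AddCommGroup.primaryComponent W.sha p)) := by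
    rw [hidx, padicValNat.mul (pow_ne_zero _ hp0) hSha0, padicValNat.prime_pow]
  refine ⟨Nat.finite_of_card_ne_zero (by rw [hidx]; exact mul_ne_zero (pow_ne_zero _ hp0) hSha0), ?_⟩
  have hTamQ : (W.tamagawaProduct : ℚ) ≠ 0 := by exact_mod_cast W.tamagawaProduct_pos_holds.ne'
  have htQ : (W.torsionOrder : ℚ) ≠ 0 := by exact_mod_cast W.torsionOrder_pos_holds.ne'
  have hrat : padicValRat p ((W.tamagawaProduct : ℚ) / (W.torsionOrder : ℚ) ^ 2) =
      (padicValNat p W.tamagawaProduct : ℤ) := by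
    rw [padicValRat.div hTamQ (pow_ne_zero 2 htQ), padicValRat.pow, padicValRat.of_nat, padicValRat.of_nat,
      htors0]
    simp
  have hv' : ((PowerSeries.coeff 1 L : ℤ_[p]) : ℚ_[p]).valuation =
      ((((PowerSeries.constantCoeff L' : ℤ_[p]) : ℚ_[p]).valuation).toNat : ℤ) := by
    rw [← hL'0]
    exact (Int.toNat_of_nonneg (PadicInt.valuation_coe_nonneg)).symm
  rw [hrat, hv', hidxval, ← hval]
  push_cast
  ring

/-! ## §2 `BSD(W, p)` from C-cc-1 and the (F)-free exact reading -/

/-- **`BSD(W, p)` ⟸ C-cc-1 (`h2`) ∧ the (F)-FREE exact reading (`hExact`) ∧ (R2) ∧ named facts**, for a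
globally minimal rank-one `W/ℚ`, `p ≥ 5`, with a good-`a_p = 0` twin datum and a generator of level `n`
— x1b's [124] `bsdp_of_plusMC_of_pAdicGrossZagierValuation_of_readings` with the pair `(h1, h74x)`
replaced by `hExact`. Arithmetic: §1 `ord Sel_str + n + ord(Tam/tors²) = v`; index `ord Sel_str = n + ord Ш`;
(C2_η-GZ) `v = 2n + ord(#Ш_an·Tam/tors²)`; hence `ord Ш = ord #Ш_an`. CONDITIONAL; (C1_η)/C-cc-1 NOT
claimed; nothing booked. [cite: Kobayashi2003, §4 (p. 8), Thm. 7.4 (p. 13)]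
[cite: GrossZagier1986, Thm. I.(7.3) 2) (p. 231)] [cite: Miller2011LMS, §1 and Def. 1.1] -/
theorem bsdp_of_pAdicGrossZagierValuation_of_exactReading
    (hmod : hasEntireLFunction_rat) (hGZ : GrossZagier1986_thm_I_7_3)
    (hGZK : rank_eq_analyticRank_of_analyticRank_le_one)
    (hPT : poitouTate_selmerStructure_duality_real ℚ)
    (hR2 : OddBranchStrictMinusNoFiniteSubmoduleAt W p)
    (hExact : ∀ (V : WeierstrassCurve ℚ) [V.IsElliptic] [V.IsGloballyMinimal] (C : VariableChange ℚ)
        {N : ℕ} [NeZero N] {f : CuspForm (Gamma0 N) 2},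
        p ≠ 2 → C • W.quadraticTwist ((-1) ^ (p / 2) * p) = V →
        V.HasGoodReductionAtPrime p → V.frobeniusTrace p = 0 → IsNewformOf V f →
        ∀ (ϖ : ℚ), (if Even (p / 2) then (ϖ : ℝ) * V.realPeriodRat = plusPeriod f
            else (ϖ : ℝ) * V.imaginaryPeriodRat = minusPeriod f) →
        ∀ (Lη : IwasawaAlgebra p), IsQuadraticBranchMinusLFunction f p ϖ Lη →
        ∀ (κ : ZpExtension ℚ p) (γ : Field.absoluteGaloisGroup ℚ),
          κ.IsCyclotomic → κ.IsTopGenerator γ → IsCyclotomicVariable p γ →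
        ∀ (D : StrictSignedSelmerDualData W κ ℚ_[p] γ (-1)) (L' : IwasawaAlgebra p),
          Lη = PowerSeries.X * L' → D.charIdeal = Ideal.span {L'})
    (h2 : QuadraticBranchMinusLeadingValuationAt W p 0)
    {V : WeierstrassCurve ℚ} [V.IsElliptic] [V.IsGloballyMinimal] {C : VariableChange ℚ}
    {N : ℕ} [NeZero N] {f : CuspForm (Gamma0 N) 2} {ϖ : ℚ} {L : IwasawaAlgebra p}
    {P : W.toAffine.Point} {n : ℕ}
    (hp5 : 5 ≤ p) (hC : C • W.quadraticTwist ((-1) ^ (p / 2) * p) = V)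
    (hgood : V.HasGoodReductionAtPrime p) (hap : V.frobeniusTrace p = 0) (hf : IsNewformOf V f)
    (hϖ : if Even (p / 2) then (ϖ : ℝ) * V.realPeriodRat = plusPeriod f
        else (ϖ : ℝ) * V.imaginaryPeriodRat = minusPeriod f)
    (hL : IsQuadraticBranchMinusLFunction f p ϖ L)
    (htors : ∀ Q : (W.baseChange ℚ_[p]).toAffine.Point, p • Q = 0 → Q = 0)
    (hP : ¬ IsOfFinAddOrder P)
    (hgen : ∀ R : W.toAffine.Point, ∃ (k : ℤ) (T : W.toAffine.Point), IsOfFinAddOrder T ∧ R = k • P + T)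
    (hdiv : ∃ Q : (W.baseChange ℚ_[p]).toAffine.Point, p ^ n • Q = W.toPadicPoint p P)
    (hndiv : ∀ Q : (W.baseChange ℚ_[p]).toAffine.Point, p ^ (n + 1) • Q ≠ W.toPadicPoint p P)
    (hr : W.analyticRank = 1) : BSDp W p := by
  obtain ⟨hrank, hfin⟩ := hGZK W hr.le
  haveI : Finite W.sha := hfin
  -- `#Ш_an ∈ ℚ^×`
  obtain ⟨s, hs⟩ := Disegni2020.exists_rat_shaAn_eq_of_analyticRank_eq_one hGZ hGZK W hr
  have hs0 : s ≠ 0 := by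
    rintro rfl
    exact AdditivePotMult.shaAn_ne_zero W hmod (by rw [hs, Rat.cast_zero])
  have hc : (W.tamagawaProduct : ℚ) ≠ 0 := by exact_mod_cast W.tamagawaProduct_pos_holds.ne'
  have ht : (W.torsionOrder : ℚ) ≠ 0 := by exact_mod_cast W.torsionOrder_pos_holds.ne'
  have hct : (W.tamagawaProduct : ℚ) / (W.torsionOrder : ℚ) ^ 2 ≠ 0 := div_ne_zero hc (pow_ne_zero 2 ht)
  -- (C2_η-GZ): `coeff₁ L ≠ 0` and `v = 2n + ord_p(s · Tam/#tors²)`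
  obtain ⟨hne, hv2⟩ := h2 V C hp5 hC hgood hap hr hf ϖ hϖ L hL htors P n hP hgen hdiv hndiv s hs
  have hsplit : padicValRat p (s * W.tamagawaProduct / (W.torsionOrder : ℚ) ^ 2) =
      padicValRat p s + padicValRat p ((W.tamagawaProduct : ℚ) / (W.torsionOrder : ℚ) ^ 2) := by
    rw [mul_div_assoc, padicValRat.mul hs0 hct]
  -- (C3_η)'s content from the (F)-free reading: `ord_p #Sel_str + n + ord_p(Tam/#tors²) = v`
  obtain ⟨-, hv3⟩ := exactControl_of_exactReading W p hPT hGZK hR2 hExact V C hp5 hC hgood hap hr hf ϖ hϖ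
    L hL htors P n hP hgen hdiv hndiv
  -- the index: `ord_p #Sel_str = n + ord_p #Ш(p)`
  haveI : Finite (AddCommGroup.primaryComponent W.sha p) := inferInstance
  have hI := (StrictSha.strictSelmerIndexAt_holds W p).padicValNat_card_eq hP hgen htors hdiv hndiv
  refine ⟨hrank, inferInstance, s, hs, ?_⟩
  rw [hI, Nat.cast_add] at hv3
  rw [hsplit, add_zero] at hv2
  linarith

/-! ## §3 The (F)-free exact reading from Kobayashi Thm. 7.4 + the (K)-form even main conjecture -/

omit [W.IsGloballyMinimal] in
/-- **THE EXACT READING FROM THE (K)-FORM.** For `W/ℚ` with complex multiplication and `p ≥ 5`: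
Kobayashi 2003 Thm. 7.4 at `η` (NAMED FACT `h74`) and the (K)-form EVEN main conjecture at `η` for CM
curves (`hC1K`: «`Char(X⁺(V/K_∞)^η) = (L_p⁺(V, η, X))`» on `Kobayashi2003.EtaSignedSelmerDualData`,
VERBATIM the binder of `PrintReadingsOfLiterature.printReadingsInert_of_plusMCEtaCM`; Pollack–Rubin
2004 p. 448 remark — CONJECTURE-GRADE, displayed) give, for every good-`a_p = 0` twin datum of `W` (the
twin is CM: same `j`) and every strict-minus dual datum `D` of `W` with `L_η = X·L′`: `Char(D) = (L′)` —
the odd main conjecture at `η` (Thm. 7.4) read on `D` by x1b's dictionary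
`StrictSignedSelmerDualData.toEtaSigned` (`K₀ = ℚ(μ_p)`, `θ² = p*`, `γ ↦ γ′ ∈ Gal(ℚ̄/K₀)`). Proof = the
second bullet of `printReadingsInert_of_plusMCEtaCM`, whose (F)-antecedent was unused. CONDITIONAL on
`hC1K`; nothing booked. [cite: Kobayashi2003, §4 (p. 8), Thm. 7.4 (p. 13)]
[cite: PollackRubin2004, Theorem and the remark on Sel over ℚ(μ_{p^∞}) (p. 448)] -/
theorem exactReading_of_etaEvenMC
    (h74 : Literature.NumberTheory.EllipticCurves.Kobayashi2003.thm74_etaEvenMC_iff_etaOddMC)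
    (hC1K : ∀ (p : ℕ) [Fact p.Prime], 5 ≤ p →
      ∀ (K₀ : Type) [Field K₀] [NumberField K₀] [IsCyclotomicExtension {p} ℚ K₀]
        [(galRange (K := ℚ) K₀).Normal] (η : absoluteGaloisGroup ℚ →* ℤˣ),
        (∀ σ ∈ galRange (K := ℚ) K₀, η σ = 1) → η ≠ 1 →
      ∀ (V : WeierstrassCurve ℚ) [V.IsElliptic] [V.IsGloballyMinimal] {N : ℕ} [NeZero N]
        {f : CuspForm (Gamma0 N) 2}, V.HasCM →
        p ≠ 2 → V.HasGoodReductionAtPrime p → V.frobeniusTrace p = 0 → IsNewformOf V f →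
      ∀ (ϖ : ℚ), (if Even (p / 2) then (ϖ : ℝ) * V.realPeriodRat = plusPeriod f
          else (ϖ : ℝ) * V.imaginaryPeriodRat = minusPeriod f) →
      ∀ (κ : ZpExtension ℚ p) (γ : absoluteGaloisGroup ℚ),
        κ.IsCyclotomic → κ.IsTopGenerator γ → γ ∈ galRange (K := ℚ) K₀ → IsCyclotomicVariable p γ →
      ∀ (Lp : IwasawaAlgebra p), IsQuadraticBranchPlusLFunction f p ϖ Lp →
      ∀ D : EtaSignedSelmerDualData V κ K₀ ℚ_[p] η γ 1, D.charIdeal = Ideal.span {Lp})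
    (hW : W.HasCM) (hp5 : 5 ≤ p) :
    ∀ (V : WeierstrassCurve ℚ) [V.IsElliptic] [V.IsGloballyMinimal] (C : VariableChange ℚ)
        {N : ℕ} [NeZero N] {f : CuspForm (Gamma0 N) 2},
        p ≠ 2 → C • W.quadraticTwist ((-1) ^ (p / 2) * p) = V →
        V.HasGoodReductionAtPrime p → V.frobeniusTrace p = 0 → IsNewformOf V f →
        ∀ (ϖ : ℚ), (if Even (p / 2) then (ϖ : ℝ) * V.realPeriodRat = plusPeriod f
            else (ϖ : ℝ) * V.imaginaryPeriodRat = minusPeriod f) →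
        ∀ (Lη : IwasawaAlgebra p), IsQuadraticBranchMinusLFunction f p ϖ Lη →
        ∀ (κ : ZpExtension ℚ p) (γ : Field.absoluteGaloisGroup ℚ),
          κ.IsCyclotomic → κ.IsTopGenerator γ → IsCyclotomicVariable p γ →
        ∀ (D : StrictSignedSelmerDualData W κ ℚ_[p] γ (-1)) (L' : IwasawaAlgebra p),
          Lη = PowerSeries.X * L' → D.charIdeal = Ideal.span {L'} := by
  intro V _ _ C N _ f hp2 hCV hgood hap hf ϖ hϖ Lη hL κ γ hκ hγ hγc D L' hLL'
  haveI : NeZero p := ⟨hp.out.ne_zero⟩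
  haveI : IsCyclotomicExtension {p} ℚ (CyclotomicField p ℚ) := CyclotomicField.isCyclotomicExtension p ℚ
  haveI : (galRange (K := ℚ) (CyclotomicField p ℚ)).Normal := normal_galRange_cyclotomic p _
  obtain ⟨θ, ηθ, hθ, hc, hη, hηK, hη1⟩ := SignedTwist.exists_theta_eta_cyclotomicField p hp2
  have hD := SignedTwist.localTowerHyp_padic p κ (CyclotomicField p ℚ) hκ
  have hκ₀ := kappa_surjOn_galRange_cyclotomic κ (CyclotomicField p ℚ)
  have hcop := coprime_index_galRange_cyclotomic p (CyclotomicField p ℚ)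
  obtain ⟨γ', hγ'K, hγ'κ⟩ := hκ₀ (κ γ)
  have hγγ' : γ⁻¹ * γ' ∈ κ.kerSubgroup := by
    rw [ZpExtension.mem_kerSubgroup, map_mul, map_inv, hγ'κ, inv_mul_cancel]
  have hγ' : κ.IsTopGenerator γ' := by rw [ZpExtension.IsTopGenerator, hγ'κ]; exact hγ
  have hγ'c : IsCyclotomicVariable p γ' := SignedTwist.isCyclotomicVariable_of_inv_mul_mem_ker hκ hγγ' hγc
  have hCMV : V.HasCM := hasCM_of_smul_quadraticTwist_eq (Additive.pStar_ne_zero p) hCV hW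
  have hEven := hC1K p hp5 (CyclotomicField p ℚ) ηθ hηK hη1 V hCMV hp2 hgood hap hf ϖ hϖ κ γ' hκ hγ' hγ'K
    hγ'c
  have hOdd := (kobayashi74Text_of_fact p h74 (CyclotomicField p ℚ) ηθ hηK hη1 V hp2 hgood hap hf ϖ hϖ κ
    γ' hκ hγ' hγ'K hγ'c).mp hEven
  have h := hOdd Lη hL
    (D.toEtaSigned W (CyclotomicField p ℚ) hθ hc p κ hCV ηθ hη ℚ_[p] hD hκ₀ hcop hγ'K hγγ') L' hLL'
  rwa [StrictSignedSelmerDualData.toEtaSigned_charIdeal] at h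

/-! ## §4 The PAIR consumer on the signed type `(p, I₀*)` in (K)-form -/

/-- **`BSD(W, p)` on the signed type `(p, I₀*)` IN (K)-FORM.** For a globally minimal CM curve `W/ℚ` of
signed local type `(p, I₀*)`, `p ≥ 5`, with `r_an(W) = 1`: `BSDp W p` ⟸ C-cc-1 at `(W, p)` (`h2`) ∧ the
(K)-form even main conjecture at `η` for CM curves (`hC1K`, conjecture-grade, displayed) ∧ the NAMED
FACTS `hmod hGZ hGZK hPT hnf hM` (modularity, Gross–Zagier I.7.3, GZK, Poitou–Tate, newforms, Mazur's
`p ∤ c₀` for the period datum via x1b [130]) and `hKO` (Kitajima–Otsuki Main Thm 1.3), `h74` (Kobayashi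
Thm 7.4 at `η`). NO `QuadraticBranchPlusMainConjectureAt`, NO `h74x`, NO `hper`. The pair data are
produced by bsd-cm's `X12.O10.pairData_elim`. CONDITIONAL; O10 stays OPEN; nothing booked.
[cite: Kobayashi2003, §4 (p. 8), Thm. 7.4 (p. 13)] [cite: KitajimaOtsuki2018, Main Thm. 1.3]
[cite: Mazur1978, Cor. 4.1] [cite: Miller2011LMS, §1 and Def. 1.1] -/
theorem bsdp_of_hasSignedLocalType_IstarZero_of_valuation_of_etaEvenMC
    (hmod : hasEntireLFunction_rat) (hGZ : GrossZagier1986_thm_I_7_3)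
    (hGZK : rank_eq_analyticRank_of_analyticRank_le_one)
    (hPT : poitouTate_selmerStructure_duality_real ℚ) (hnf : exists_isNewformOf)
    (hM : mazur_not_dvd_maninConstant_of_odd)
    (hKO : Literature.NumberTheory.EllipticCurves.KitajimaOtsuki2018.mainThm13_etaSignedSelmerDual_noFiniteSubmodule)
    (h74 : Literature.NumberTheory.EllipticCurves.Kobayashi2003.thm74_etaEvenMC_iff_etaOddMC)
    (hC1K : ∀ (p : ℕ) [Fact p.Prime], 5 ≤ p →
      ∀ (K₀ : Type) [Field K₀] [NumberField K₀] [IsCyclotomicExtension {p} ℚ K₀]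
        [(galRange (K := ℚ) K₀).Normal] (η : absoluteGaloisGroup ℚ →* ℤˣ),
        (∀ σ ∈ galRange (K := ℚ) K₀, η σ = 1) → η ≠ 1 →
      ∀ (V : WeierstrassCurve ℚ) [V.IsElliptic] [V.IsGloballyMinimal] {N : ℕ} [NeZero N]
        {f : CuspForm (Gamma0 N) 2}, V.HasCM →
        p ≠ 2 → V.HasGoodReductionAtPrime p → V.frobeniusTrace p = 0 → IsNewformOf V f →
      ∀ (ϖ : ℚ), (if Even (p / 2) then (ϖ : ℝ) * V.realPeriodRat = plusPeriod f
          else (ϖ : ℝ) * V.imaginaryPeriodRat = minusPeriod f) →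
      ∀ (κ : ZpExtension ℚ p) (γ : absoluteGaloisGroup ℚ),
        κ.IsCyclotomic → κ.IsTopGenerator γ → γ ∈ galRange (K := ℚ) K₀ → IsCyclotomicVariable p γ →
      ∀ (Lp : IwasawaAlgebra p), IsQuadraticBranchPlusLFunction f p ϖ Lp →
      ∀ D : EtaSignedSelmerDualData V κ K₀ ℚ_[p] η γ 1, D.charIdeal = Ideal.span {Lp})
    (h2 : QuadraticBranchPAdicGrossZagierValuationAt W p)
    (hT : HasSignedLocalType W p (.Istar 0)) (hr : W.analyticRank = 1) (hp5 : 5 ≤ p) : BSDp W p :=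
  pairData_elim hGZK hnf (periodRatio_of_mazur p hM hp5) W hT hr hp5
    fun _ _ _ _ _ _ _ _ _ _ _ hC hgood hap _hCM _hin hf hϖ hL htors hP hgen hdiv hndiv ↦
      bsdp_of_pAdicGrossZagierValuation_of_exactReading W p hmod hGZ hGZK hPT
        (oddBranchStrictMinusNoFiniteSubmoduleAt_of_kitajimaOtsuki W p hKO)
        (exactReading_of_etaEvenMC W p h74 hC1K hT.1 hp5)
        ((quadraticBranchPAdicGrossZagierValuationAt_iff W p).mp h2) hp5 hC hgood hap hf hϖ hL htors hP
        hgen hdiv hndiv hr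

/-- **The typed O10 residue at the pair, (K)-form**: `X12.MissingInputAt W p` (and the lower half
`MissingLowerBoundAt W p`) for `W` of signed type `(p, I₀*)`, `r_an = 1`, `p ≥ 5`, from the same inputs.
CONDITIONAL; nothing booked. [cite: Kobayashi2003, §4 (p. 8), Thm. 7.4 (p. 13)] [cite: Miller2011LMS, §1 and Def. 1.1] -/
theorem missingLowerBoundAt_of_hasSignedLocalType_IstarZero_of_valuation_of_etaEvenMC
    (hmod : hasEntireLFunction_rat) (hGZ : GrossZagier1986_thm_I_7_3)
    (hGZK : rank_eq_analyticRank_of_analyticRank_le_one)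
    (hPT : poitouTate_selmerStructure_duality_real ℚ) (hnf : exists_isNewformOf)
    (hM : mazur_not_dvd_maninConstant_of_odd)
    (hKO : Literature.NumberTheory.EllipticCurves.KitajimaOtsuki2018.mainThm13_etaSignedSelmerDual_noFiniteSubmodule)
    (h74 : Literature.NumberTheory.EllipticCurves.Kobayashi2003.thm74_etaEvenMC_iff_etaOddMC)
    (hC1K : ∀ (p : ℕ) [Fact p.Prime], 5 ≤ p →
      ∀ (K₀ : Type) [Field K₀] [NumberField K₀] [IsCyclotomicExtension {p} ℚ K₀]
        [(galRange (K := ℚ) K₀).Normal] (η : absoluteGaloisGroup ℚ →* ℤˣ),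
        (∀ σ ∈ galRange (K := ℚ) K₀, η σ = 1) → η ≠ 1 →
      ∀ (V : WeierstrassCurve ℚ) [V.IsElliptic] [V.IsGloballyMinimal] {N : ℕ} [NeZero N]
        {f : CuspForm (Gamma0 N) 2}, V.HasCM →
        p ≠ 2 → V.HasGoodReductionAtPrime p → V.frobeniusTrace p = 0 → IsNewformOf V f →
      ∀ (ϖ : ℚ), (if Even (p / 2) then (ϖ : ℝ) * V.realPeriodRat = plusPeriod f
          else (ϖ : ℝ) * V.imaginaryPeriodRat = minusPeriod f) →
      ∀ (κ : ZpExtension ℚ p) (γ : absoluteGaloisGroup ℚ),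
        κ.IsCyclotomic → κ.IsTopGenerator γ → γ ∈ galRange (K := ℚ) K₀ → IsCyclotomicVariable p γ →
      ∀ (Lp : IwasawaAlgebra p), IsQuadraticBranchPlusLFunction f p ϖ Lp →
      ∀ D : EtaSignedSelmerDualData V κ K₀ ℚ_[p] η γ 1, D.charIdeal = Ideal.span {Lp})
    (h2 : QuadraticBranchPAdicGrossZagierValuationAt W p)
    (hT : HasSignedLocalType W p (.Istar 0)) (hr : W.analyticRank = 1) (hp5 : 5 ≤ p) :
    MissingLowerBoundAt W p ∧ X12.MissingInputAt W p := by
  have hB := bsdp_of_hasSignedLocalType_IstarZero_of_valuation_of_etaEvenMC W p hmod hGZ hGZK hPT hnf hM hKO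
    h74 hC1K h2 hT hr hp5
  haveI : Finite W.sha := (hGZK W hr.le).2
  exact ⟨(lower_and_upper_of_missingPPartAt W p (missingPPartAt_of_bsdp W p hB)).1,
    fun _ ↦ missingPPartAt_of_bsdp W p hB⟩

end Summit.BirchSwinnertonDyer.BirchSwinnertonDyer.Theorems.KFormReadings

end
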